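import Summits.QuantumFields.YangMills.Theorems.LuscherReductionTwistedTraceScalingLevelFloorDoors
import Summits.QuantumFields.YangMills.Theorems.LuscherReductionTwistedTraceScalingOneSiteNearLevel
import Summits.QuantumFields.YangMills.Theorems.LuscherReductionTwistedTraceScalingLambda0Upper
import HarnessLib

/-!
# The LEVEL-`k` FLOOR `e^{−ελ_b}·recordSigma·μ_k(L³β) ≤ λ_k(β, L)` and the relative Born–Oppenheimer lower comparison ★★★ `BO_lower(L)` for every `L ≥ 2`
# (lane A of S-BASE, crux `TwistedTraceScaling` stmt-QuantumFields-20203, line «twolattice», stub `stub_fixedLatticeTraceLaw`; lead g23; `HANDOFF-g23.md`)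

COARSE-LOWER(L₁) — hypothesis `hLow` of ✓`Base.fixedLatticeTraceLaw_of_coarse L₁`: for every `k`, `ε > 0`, deep in the femto window, `e^{−(Δ_k+ε)Λ/L₁}·λ₀ ≤ λ_k` — is, by
✓`BOHandover.coarseLowerAt_of_boLower L₁` and crux ONE (pattern of ✓`Base.coarseLower_one`), a consequence of the RELATIVE lower comparison
`BO_lower(L) : μ_k(L³β)·λ₀(β,L) ≤ e^{ελ_b(L³β)}·λ_k(β,L)·μ₀(L³β)` eventually in `β`.  With the common slow factor `σ = recordSigma L β` of the C4-CORE record this is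
(U) ✓`lambda0_le_record` (`λ₀ ≤ e^{ελ_b}σμ₀`, `…Lambda0Upper`) times the level-`k` FLOOR (F_k) `e^{−ελ_b}σμ_k ≤ λ_k`, proved here:
* §1 `arith_level` — the real endgame;
* §2 ★★ `levelFloor_of_boBricks (K : BOBricks L χ δ) (hup : ∀ᶠ β, λ₀ ≤ e^{λ_b}·K.σ·μ₀) k ε` — `∀ᶠ β, e^{−ελ_b}·(K.σ β·μ_k(L³β)) ≤ λ_k(β, L)`: the localised level-`k` one-site family
  ✓`exists_localized_near_level` (radius `13(L³β)^{−1/5} ⊆ 𝒰`, `hcore`), its BO lifts `fᵢ = boFun φᵢ Ω` (linear in `φ`), the two-sided kernel brick (B-T) and the fibre mass (B-N)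
  on every combination (`T(f_a) ≥ σγ[(1−κ)e^{−y/4} − 2κ]μ_k‖φ_a‖²`, `‖f_a‖²_w ≤ γ(1+κ)‖φ_a‖²`, `μ₀ ≤ 2μ_k` by ONE), the level-`k` tube glue ✓`le_levelValue_of_tube_family`, and the
  copies' cross terms through `hup` (`28·crossBound ≤ (y/48)λ₀ ≤ (y/8)σμ_k`);
* §3 ★★★ `levelFloor_record (hL2 : 2 ≤ L) k ε : ∀ᶠ β, e^{−ελ_b(L³β)}·(recordSigma L β·μ_k(L³β)) ≤ λ_k(β, L)`;
  ★★★ `boLower_record (hL2) : BO_lower(L)` — the hypothesis `hBO` of ✓`BOHandover.coarseLowerAt_of_boLower L`; COARSE-LOWER(L) itself (verbatim `hLow` of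
  ✓`Base.fixedLatticeTraceLaw_of_coarse L`) is the one-line composition with crux ONE, filed separately (`…TwistedTraceScalingCoarseLower`, theses cone).
HONEST FRAMING: fixed lattice size `L ≥ 2`, eventually in `β`; the window floor W(L) ∕ COARSE-TAIL(L), `stub_cmpTwoLoop` and the crux `TwistedTraceScaling` stay OPEN; CONDITIONAL
route R2b1 (Lüscher two-lattice reduction); not infinite volume, not a mass gap, not Clay.  No named facts, no `sorry`.
-/

set_option autoImplicit false

noncomputable section

open MeasureTheory Filter Topology Real
open scoped BigOperators
open Literature.MathematicalPhysics.QuantumFieldTheory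
open Literature.MathematicalPhysics.QuantumLattice

namespace Summit.QuantumFields.YangMills.Theorems.FemtoTransferGap.TwoLattice.ConstTube

open Summit.QuantumFields.YangMills.Theorems.FemtoTransferGap
open Summit.QuantumFields.YangMills.Theorems.FemtoTransferGap.TwoLattice.Avg

variable {L : ℕ} [NeZero L]

/-! ## §1 The real endgame -/

/-- `0 < y ≤ 1`, `0 ≤ κ ≤ y/96` ⇒ `e^{−y} ≤ ((1−κ)e^{−y/4} − 2κ)/(1+κ) − y/32`. [folklore] -/
theorem arith_level {y κ : ℝ} (hy0 : 0 < y) (hy1 : y ≤ 1) (hκ0 : 0 ≤ κ) (hκ : κ ≤ y / 96) :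
    Real.exp (-y) ≤ ((1 - κ) * Real.exp (-(y / 4)) - 2 * κ) / (1 + κ) - y / 32 := by
  have hA : 1 - y / 4 ≤ Real.exp (-(y / 4)) := by have := Real.add_one_le_exp (-(y / 4)); linarith
  have hB : Real.exp (-y) * (1 + y) ≤ 1 := by
    rw [Real.exp_neg, inv_mul_le_iff₀ (Real.exp_pos y), mul_one]
    have := Real.add_one_le_exp y
    linarith
  have hpoly : (1 + y * (1 + y) / 32) * (1 + κ) ≤ ((1 - κ) * (1 - y / 4) - 2 * κ) * (1 + y) := by
    nlinarith [mul_le_mul_of_nonneg_right hκ hy0.le, mul_le_mul_of_nonneg_right hκ (sq_nonneg y), mul_nonneg hκ0 hy0.le,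
      mul_nonneg hκ0 (sq_nonneg y), mul_le_mul_of_nonneg_left hy1 hy0.le, mul_le_mul_of_nonneg_left hy1 (sq_nonneg y)]
  have h1 : (Real.exp (-y) + y / 32) * (1 + κ) * (1 + y) ≤ ((1 - κ) * (1 - y / 4) - 2 * κ) * (1 + y) := by
    have h := mul_le_mul_of_nonneg_left hB (by linarith : (0 : ℝ) ≤ 1 + κ)
    nlinarith [h, hpoly, hκ0, hy0]
  have h2 : (Real.exp (-y) + y / 32) * (1 + κ) ≤ (1 - κ) * (1 - y / 4) - 2 * κ := le_of_mul_le_mul_right h1 (by linarith)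
  have h3 : (1 - κ) * (1 - y / 4) ≤ (1 - κ) * Real.exp (-(y / 4)) := mul_le_mul_of_nonneg_left hA (by linarith)
  rw [le_sub_iff_add_le, le_div_iff₀ (by linarith : (0 : ℝ) < 1 + κ)]
  linarith

/-! ## §2 ★★ The level-`k` floor from the bricks -/

/-- `boFun` is linear in the slow amplitude. [folklore] -/
theorem boFun_sum_mul {k : ℕ} (a : Fin (k + 1) → ℝ) (φ : Fin (k + 1) → GaugeConfig 3 1 SU2 → ℝ) (Ω : Stiff.LinkSpace L → ℝ) :
    (fun U => ∑ i, a i * boFun L (φ i) Ω U) = boFun L (fun u => ∑ i, a i * φ i u) Ω := by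
  funext U
  show ∑ i, a i * ((orthoTubeSet L).indicator (fun _ => (1 : ℝ)) U * (φ i (slowMean L U) * Ω (relLinkVec L U))) =
    (orthoTubeSet L).indicator (fun _ => (1 : ℝ)) U * ((∑ i, a i * φ i (slowMean L U)) * Ω (relLinkVec L U))
  rw [Finset.sum_mul, Finset.mul_sum]
  exact Finset.sum_congr rfl fun i _ => by ring

set_option maxHeartbeats 800000 in
/-- ★★ **THE LEVEL-`k` FLOOR FROM THE BRICKS**: from `BOBricks L χ δ` and the sup bound `λ₀ ≤ e^{λ_b}·σ·μ₀` eventually (in the brick list's `σ`), for every `k` and `ε > 0`: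
`∀ᶠ β, e^{−ελ_b(L³β)}·(σ·μ_k(L³β)) ≤ λ_k(β, L)`. [cite: Luscher1983, §3] [cite: ReedSimonIV1978, Thm. XIII.1] -/
theorem levelFloor_of_boBricks {χ : ℝ → GaugeConfig 3 L SU2 → ℝ} {δ : ℝ → ℝ} (K : BOBricks L χ δ)
    (hup : ∀ᶠ β : ℝ in atTop, levelValue su2Rep L β 0 ≤ Real.exp (bareLambda ((L : ℝ) ^ 3 * β)) * (K.σ β * levelValue su2Rep 1 ((L : ℝ) ^ 3 * β) 0))
    (k : ℕ) {ε : ℝ} (hε : 0 < ε) :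
    ∀ᶠ β : ℝ in atTop, Real.exp (-(ε * bareLambda ((L : ℝ) ^ 3 * β))) * (K.σ β * levelValue su2Rep 1 ((L : ℝ) ^ 3 * β) k) ≤ levelValue su2Rep L β k := by
  have hL1 : (1 : ℝ) ≤ (L : ℝ) ^ 3 := one_le_pow₀ (by exact_mod_cast NeZero.one_le)
  -- WLOG `ε ≤ 1`
  set ε₁ : ℝ := min ε 1 with hε₁def
  have hε₁ : 0 < ε₁ := lt_min hε one_pos
  have hε₁1 : ε₁ ≤ 1 := min_le_right _ _
  have hε₁ε : ε₁ ≤ ε := min_le_left _ _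
  -- ONE at level `k`
  obtain ⟨C1, B0, hONE⟩ := oneSiteLevels_proof k
  set τ : ℝ := 1 / (2 * (|levelGap k| + |C1| + 2)) with hτ
  have hτ0 : 0 < τ := by rw [hτ]; positivity
  -- the localised family and the copies
  obtain ⟨βNL, hNL⟩ := exists_localized_near_level k (ε₁ / 4) (by positivity)
  obtain ⟨βc, hcross⟩ := crossBound_eventually_small (L := L) (m := K.m) K.hm0 (ε := ε₁ / 48) (by positivity)
  filter_upwards [Filter.eventually_ge_atTop (max (max 2 B0) (max (max βNL βc) (2 / τ ^ 3))), K.hκ_small (ε₁ / 96) (by positivity), K.hcore, K.hbo, K.hδ₂,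
    K.hN, K.hT, hup] with β hβ hκs hcore hbo hδ₂ hN hT hupβ
  -- numbers
  have hβ2 : 2 ≤ β := ((le_max_left _ _).trans (le_max_left _ _)).trans hβ
  have hβB0 : B0 ≤ β := ((le_max_right _ _).trans (le_max_left _ _)).trans hβ
  have hβNL : βNL ≤ β := (((le_max_left _ _).trans (le_max_left _ _)).trans (le_max_right _ _)).trans hβ
  have hβc : βc ≤ β := (((le_max_right _ _).trans (le_max_left _ _)).trans (le_max_right _ _)).trans hβ
  have hβτ : 2 / τ ^ 3 ≤ β := ((le_max_right _ _).trans (le_max_right _ _)).trans hβ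
  have hβ1 : 1 ≤ β := by linarith only [hβ2]
  have hβ0 : 0 < β := by linarith only [hβ2]
  have hBβ : β ≤ (L : ℝ) ^ 3 * β := by nlinarith only [hL1, hβ0]
  have hB0 : 0 < (L : ℝ) ^ 3 * β := lt_of_lt_of_le hβ0 hBβ
  have hlam0 : 0 < bareLambda ((L : ℝ) ^ 3 * β) := bareLambda_pos' hB0
  have hlamτ : bareLambda ((L : ℝ) ^ 3 * β) ≤ τ := bareLambda_cube_le (L := L) hτ0 hβτ
  obtain ⟨-, -, hsm⟩ := smallness_of_le hlam0.le (hlamτ.trans (le_of_eq hτ))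
  have hlam1 : bareLambda ((L : ℝ) ^ 3 * β) ≤ 1 := by
    have h22 : τ ≤ 1 / (2 * 2) := by
      rw [hτ]; apply div_le_div_of_nonneg_left (by norm_num) (by norm_num)
      nlinarith only [abs_nonneg (levelGap k), abs_nonneg C1]
    linarith only [hlamτ, h22]
  obtain ⟨hμ0, -, hμk⟩ := hONE ((L : ℝ) ^ 3 * β) (hβB0.trans hBβ)
  have hμk' : Real.exp (-(levelGap k * bareLambda ((L : ℝ) ^ 3 * β) + |C1| * bareLambda ((L : ℝ) ^ 3 * β) ^ 2)) * levelValue su2Rep 1 ((L : ℝ) ^ 3 * β) 0 ≤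
      levelValue su2Rep 1 ((L : ℝ) ^ 3 * β) k := by
    refine le_trans (mul_le_mul_of_nonneg_right (Real.exp_le_exp.2 ?_) hμ0.le) hμk
    have := mul_le_mul_of_nonneg_right (le_abs_self C1) (sq_nonneg (bareLambda ((L : ℝ) ^ 3 * β)))
    linarith only [this]
  have hμk2 := half_le_of_exp_lower hsm hμ0.le hμk'
  -- abbreviations
  set B : ℝ := (L : ℝ) ^ 3 * β with hBdef
  set lam : ℝ := bareLambda B with hlamdef
  set μ0 : ℝ := levelValue su2Rep 1 B 0 with hμ0def
  set μk : ℝ := levelValue su2Rep 1 B k with hμkdef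
  have hμkpos : 0 < μk := by linarith only [hμk2, hμ0]
  set y : ℝ := ε₁ * lam with hydef
  have hy0 : 0 < y := by positivity
  have hy1 : y ≤ 1 := by rw [hydef]; nlinarith only [hε₁1, hlam1, hlam0, hε₁]
  have hκ0 := K.hκ β
  have hκy : K.κ β ≤ y / 96 := by rw [hydef]; linarith only [hκs]
  have hκ1 : K.κ β ≤ 1 := by linarith only [hκy, hy1]
  obtain ⟨Cw, hCw⟩ := K.hwb β
  obtain ⟨hc0, hcχ⟩ := K.hc β
  have hσ0 := K.hσ β
  have hγ0 := K.hγ β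
  -- the localised family and its BO lifts
  obtain ⟨φ, hφm, hφb, hφg, hφsupp, hφmain⟩ := hNL B (hβNL.trans hBβ)
  have hφs : ∀ i u, φ i u ≠ 0 → u ∈ K.𝒰 β := fun i u hu => hcore u (hφsupp i u hu)
  -- data of the combinations `φ_a`
  have hφa : ∀ a : Fin (k + 1) → ℝ, Measurable (fun u => ∑ i, a i * φ i u) ∧ (∃ C : ℝ, ∀ u, |(fun u => ∑ i, a i * φ i u) u| ≤ C) ∧
      (∀ (g : Site 3 1 → SU2) (u : GaugeConfig 3 1 SU2), (fun u => ∑ i, a i * φ i u) (gaugeTransform g u) = (fun u => ∑ i, a i * φ i u) u) ∧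
      (∀ u, (fun u => ∑ i, a i * φ i u) u ≠ 0 → u ∈ K.𝒰 β) := fun a => by
    refine ⟨Finset.measurable_sum _ fun i _ => measurable_const.mul (hφm i), ?_, fun g u => ?_, fun u hu => ?_⟩
    · choose C hC using hφb
      refine ⟨∑ i, |a i| * C i, fun u => ?_⟩
      calc |∑ i, a i * φ i u| ≤ ∑ i, |a i * φ i u| := Finset.abs_sum_le_sum_abs _ _
        _ ≤ ∑ i, |a i| * C i := Finset.sum_le_sum fun i _ => by rw [abs_mul]; exact mul_le_mul_of_nonneg_left (hC i u) (abs_nonneg _)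
    · show ∑ i, a i * φ i (gaugeTransform g u) = ∑ i, a i * φ i u
      exact Finset.sum_congr rfl fun i _ => by rw [hφg i g u]
    · obtain ⟨i, -, hi⟩ := Finset.exists_ne_zero_of_sum_ne_zero hu
      exact hφs i u (right_ne_zero_of_mul hi)
  -- the bracket `c₁ = (1−κ)e^{−y/4} − 2κ > 0`
  set c₁ : ℝ := (1 - K.κ β) * Real.exp (-(y / 4)) - 2 * K.κ β with hc₁def
  have hE4 : 1 - y / 4 ≤ Real.exp (-(y / 4)) := by have := Real.add_one_le_exp (-(y / 4)); linarith only [this]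
  have hc₁0 : 0 < c₁ := by
    rw [hc₁def]
    have h34 : 3 / 4 ≤ Real.exp (-(y / 4)) := by linarith only [hE4, hy1]
    nlinarith only [h34, hκy, hy1, hκ0]
  -- the lower bound on every combination, in tube currency
  set s : ℝ := K.σ β * μk * (c₁ / (1 + K.κ β)) with hsdef
  have hs0 : 0 ≤ s := by rw [hsdef]; positivity
  have hcomb : ∀ a : Fin (k + 1) → ℝ,
      K.σ β * K.γ β * μk * c₁ * l2 (fun u => ∑ i, a i * φ i u) (fun u => ∑ i, a i * φ i u) ≤ tubeForm β (fun U => ∑ i, a i * boFun L (φ i) (K.Ω β) U) ∧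
      tubeNormSq (softWeight (χ β)) (fun U => ∑ i, a i * boFun L (φ i) (K.Ω β) U) ≤
        K.γ β * (1 + K.κ β) * l2 (fun u => ∑ i, a i * φ i u) (fun u => ∑ i, a i * φ i u) := fun a => by
    obtain ⟨ham, ⟨Ca, hCa⟩, hag, has⟩ := hφa a
    rw [boFun_sum_mul a φ (K.Ω β)]
    have hTa := hT _ ham ⟨Ca, hCa⟩ hag has
    have hTlow := (abs_le.mp hTa).1
    have hq := (hφmain a).2
    have hl2 : 0 ≤ l2 (fun u => ∑ i, a i * φ i u) (fun u => ∑ i, a i * φ i u) := l2_self_nonneg_lat _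
    refine ⟨?_, ?_⟩
    · -- `T ≥ σγ(1−κ)q − κσγμ₀‖φ_a‖² ≥ σγμ_k[(1−κ)e^{−y/4} − 2κ]‖φ_a‖²`
      have h1 : K.σ β * K.γ β * (1 - K.κ β) * (Real.exp (-(ε₁ / 4 * bareLambda B)) * μk * l2 (fun u => ∑ i, a i * φ i u) (fun u => ∑ i, a i * φ i u)) ≤
          K.σ β * K.γ β * (1 - K.κ β) * qform su2Rep B (fun u => ∑ i, a i * φ i u) (fun u => ∑ i, a i * φ i u) :=
        mul_le_mul_of_nonneg_left hq (mul_nonneg (mul_nonneg hσ0.le hγ0.le) (by linarith only [hκ1]))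
      have h2 : K.κ β * (K.σ β * K.γ β) * (levelValue su2Rep 1 B 0 * l2 (fun u => ∑ i, a i * φ i u) (fun u => ∑ i, a i * φ i u)) ≤
          K.κ β * (K.σ β * K.γ β) * (2 * μk * l2 (fun u => ∑ i, a i * φ i u) (fun u => ∑ i, a i * φ i u)) := by
        refine mul_le_mul_of_nonneg_left (mul_le_mul_of_nonneg_right ?_ hl2) (by positivity)
        linarith only [hμk2]
      have e4 : Real.exp (-(ε₁ / 4 * bareLambda B)) = Real.exp (-(y / 4)) := by rw [hydef, hlamdef]; ring_nf
      rw [e4] at h1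
      rw [hc₁def]
      nlinarith only [h1, h2, hTlow, hl2, hσ0, hγ0, hκ0]
    · have hΓ : ∀ u ∈ K.𝒰 β, fibreMass L (softWeight (χ β)) (K.Ω β) u ≤ K.γ β * (1 + K.κ β) := fun u hu => by
        have := (abs_le.mp (hN u hu)).2; linarith only [this]
      rw [l2_self_eq_integral_sq]
      exact tubeNormSq_boFun_le ham hCa (K.hΩm β) (K.hΩ1 β) (K.hwm β) hCw has hΓ
  -- hypotheses of the tube glue
  have hfm : ∀ i, Measurable (boFun L (φ i) (K.Ω β)) := fun i => measurable_boFun L (hφm i) (K.hΩm β)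
  have hfb : ∀ i, ∃ C : ℝ, ∀ U, |boFun L (φ i) (K.Ω β) U| ≤ C := fun i => by
    obtain ⟨C, hC⟩ := hφb i
    exact ⟨C * 1, abs_boFun_le L hC (K.hΩ1 β)⟩
  have hfχ : ∀ i U, χ β U = 0 → boFun L (φ i) (K.Ω β) U = 0 := fun i U hU => by
    by_contra h; exact (hbo (φ i) U (hφs i) h).1 hU
  have hfδ : ∀ i U, boFun L (φ i) (K.Ω β) U ≠ 0 → orbitDist U < K.δ₂ β := fun i U h => (hbo (φ i) U (hφs i) h).2
  have hs : ∀ a : Fin (k + 1) → ℝ, s * tubeNormSq (softWeight (χ β)) (fun U => ∑ i, a i * boFun L (φ i) (K.Ω β) U) ≤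
      tubeForm β (fun U => ∑ i, a i * boFun L (φ i) (K.Ω β) U) := fun a => by
    obtain ⟨hlow, hnorm⟩ := hcomb a
    have hl2 : 0 ≤ l2 (fun u => ∑ i, a i * φ i u) (fun u => ∑ i, a i * φ i u) := l2_self_nonneg_lat _
    have h1 : s * tubeNormSq (softWeight (χ β)) (fun U => ∑ i, a i * boFun L (φ i) (K.Ω β) U) ≤
        s * (K.γ β * (1 + K.κ β) * l2 (fun u => ∑ i, a i * φ i u) (fun u => ∑ i, a i * φ i u)) := mul_le_mul_of_nonneg_left hnorm hs0
    have e : s * (K.γ β * (1 + K.κ β) * l2 (fun u => ∑ i, a i * φ i u) (fun u => ∑ i, a i * φ i u)) =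
        K.σ β * K.γ β * μk * c₁ * l2 (fun u => ∑ i, a i * φ i u) (fun u => ∑ i, a i * φ i u) := by
      rw [hsdef]; field_simp
    exact h1.trans (e.le.trans hlow)
  have hpos : ∀ a : Fin (k + 1) → ℝ, a ≠ 0 → 0 < tubeForm β (fun U => ∑ i, a i * boFun L (φ i) (K.Ω β) U) := fun a ha => by
    obtain ⟨hlow, -⟩ := hcomb a
    have hl2 := (hφmain a).1 ha
    exact lt_of_lt_of_le (by positivity) hlow
  have hglue := le_levelValue_of_tube_family hβ0.le K.hm hδ₂ (K.hχm β) (K.hχ1 β) (K.hχ0 β) hc0 hcχ hfm hfb hfχ hfδ hs0 hs hpos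
  -- the copies' cross terms through `hup`: `7 cB ≤ (y/32)·σ·μ_k`
  have he3 : Real.exp lam ≤ 3 := by
    have h := Real.exp_one_lt_d9
    have : Real.exp lam ≤ Real.exp 1 := Real.exp_le_exp.2 hlam1
    linarith only [h, this]
  have hcB : 7 * crossBound L β K.m ≤ y / 32 * (K.σ β * μk) := by
    have h1 : 28 * crossBound L β K.m ≤ ε₁ / 48 * lam * levelValue su2Rep L β 0 :=
      (hcross β hβc).trans (mul_le_mul_of_nonneg_left (levelValue_zero_ge_uniform hβ1) (by positivity))
    have h2 : levelValue su2Rep L β 0 ≤ 3 * (K.σ β * (2 * μk)) :=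
      hupβ.trans (mul_le_mul he3 (mul_le_mul_of_nonneg_left (by linarith only [hμk2]) hσ0.le) (by positivity) (by norm_num))
    have h3 := mul_le_mul_of_nonneg_left h2 (show 0 ≤ ε₁ / 48 * lam by positivity)
    rw [hydef]
    nlinarith only [h1, h3]
  -- endgame
  have harith := arith_level hy0 hy1 hκ0 hκy
  have hεy : Real.exp (-(ε * lam)) ≤ Real.exp (-y) := by
    refine Real.exp_le_exp.2 ?_
    have := mul_le_mul_of_nonneg_right hε₁ε hlam0.le
    rw [hydef]; linarith only [this]
  have hSμ : 0 ≤ K.σ β * μk := by positivity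
  calc Real.exp (-(ε * lam)) * (K.σ β * μk) ≤ Real.exp (-y) * (K.σ β * μk) := mul_le_mul_of_nonneg_right hεy hSμ
    _ ≤ (c₁ / (1 + K.κ β) - y / 32) * (K.σ β * μk) := mul_le_mul_of_nonneg_right harith hSμ
    _ = s - y / 32 * (K.σ β * μk) := by rw [hsdef]; ring
    _ ≤ s - 7 * crossBound L β K.m := by linarith only [hcB]
    _ ≤ levelValue su2Rep L β k := hglue

/-! ## §3 ★★★ The record: the level-`k` floor and BO_lower(L) -/

/-- ★★★ **THE LEVEL-`k` FLOOR OF THE RECORD** (`L ≥ 2`, every `k`, every `ε > 0`): `∀ᶠ β, e^{−ελ_b(L³β)}·(recordSigma L β·μ_k(L³β)) ≤ λ_k(β, L)`.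
[cite: Luscher1983, §3] [cite: ReedSimonIV1978, Thm. XIII.1] -/
theorem levelFloor_record (hL2 : 2 ≤ L) (k : ℕ) {ε : ℝ} (hε : 0 < ε) :
    ∀ᶠ β : ℝ in atTop, Real.exp (-(ε * bareLambda ((L : ℝ) ^ 3 * β))) * (recordSigma L β * levelValue su2Rep 1 ((L : ℝ) ^ 3 * β) k) ≤
      levelValue su2Rep L β k := by
  have hLz : Nonempty (NzSite L) := nonempty_nzSite_of_two_le hL2
  have hs0 : (0 : ℝ) < 9 / 50 := by norm_num
  obtain ⟨M₀, hM₀, hrec⟩ := recordAnalyticInput_x (L := L) hLz hL2 (s := 9 / 50) (by norm_num) (by norm_num)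
  have hδ0 : ∀ β, 0 < 43 * powScale (9 / 50) β := fun β => mul_pos (by norm_num) (powScale_pos _ β)
  have hδt : Tendsto (fun β => 43 * powScale (9 / 50) β) atTop (𝓝 0) := by
    have := (tendsto_powScale hs0).const_mul 43; simpa using this
  have hsd : ∀ᶠ β in atTop, 0 < powScale 1 β ∧ powScale 1 β ≤ (43 * powScale (9 / 50) β) ^ 3 := by
    filter_upwards [Filter.eventually_ge_atTop (1 : ℝ)] with β hβ
    refine ⟨powScale_pos 1 β, (powScale_one_le_cube (σ := 9 / 50) (by norm_num) hβ).trans ?_⟩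
    have hp := powScale_pos (9 / 50) β
    have h1 : powScale (9 / 50) β ≤ 43 * powScale (9 / 50) β := by nlinarith
    exact pow_le_pow_left₀ hp.le h1 3
  obtain ⟨M₁, hM₁, hPM⟩ := fpWeight_core_constant L hLz hδ0 hδt hsd
  obtain ⟨A, -, -, hAσ⟩ := hrec (max M₀ M₁) (le_max_left _ _)
  obtain ⟨C, β₀, -, hP⟩ := hPM (max M₀ M₁) (le_max_right _ _)
  have hM1 : 1 ≤ max M₀ M₁ := le_trans (by linarith) (le_max_left _ _)
  set K : BOBricks L (recordChi L (9 / 50) 43 (max M₀ M₁)) (powScale (9 / 50)) :=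
    boBricks_record hs0 hM1 (A.toRecordBOInput hs0 (by norm_num) (by linarith)) (C := C) (β₀ := β₀) fun β hβ U hU => hP β hβ U hU with hKdef
  have hup : ∀ᶠ β : ℝ in atTop, levelValue su2Rep L β 0 ≤ Real.exp (bareLambda ((L : ℝ) ^ 3 * β)) * (K.σ β * levelValue su2Rep 1 ((L : ℝ) ^ 3 * β) 0) := by
    filter_upwards [lambda0_le_record hL2 one_pos, Filter.eventually_ge_atTop (0 : ℝ)] with β hβ hβ0
    rw [one_mul] at hβ
    have e : K.σ β = recordSigma L β := hAσ β hβ0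
    rw [e]; exact hβ
  filter_upwards [levelFloor_of_boBricks K hup k hε, Filter.eventually_ge_atTop (0 : ℝ)] with β hβ hβ0
  have e : K.σ β = recordSigma L β := hAσ β hβ0
  rw [← e]; exact hβ

/-- ★★★ **BO_lower(L)** (`L ≥ 2`): `∀ k, ∀ ε > 0, ∃ β₀, ∀ β ≥ β₀, μ_k(L³β)·λ₀(β, L) ≤ e^{ελ_b(L³β)}·(λ_k(β, L)·μ₀(L³β))` — the relative Born–Oppenheimer lower comparison,
from ✓`lambda0_le_record` and `levelFloor_record` (the slow factor `recordSigma` cancels). [cite: Luscher1983, §3] [cite: SimonB1983DiscreteSpectrum, §3] -/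
theorem boLower_record (hL2 : 2 ≤ L) : ∀ k : ℕ, ∀ ε : ℝ, 0 < ε → ∃ β0 : ℝ, ∀ β : ℝ, β0 ≤ β →
    levelValue su2Rep 1 ((L : ℝ) ^ 3 * β) k * levelValue su2Rep L β 0 ≤
      Real.exp (ε * bareLambda ((L : ℝ) ^ 3 * β)) * (levelValue su2Rep L β k * levelValue su2Rep 1 ((L : ℝ) ^ 3 * β) 0) := by
  intro k ε hε
  have hL1 : (1 : ℝ) ≤ (L : ℝ) ^ 3 := one_le_pow₀ (by exact_mod_cast NeZero.one_le)
  have hev : ∀ᶠ β : ℝ in atTop, levelValue su2Rep 1 ((L : ℝ) ^ 3 * β) k * levelValue su2Rep L β 0 ≤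
      Real.exp (ε * bareLambda ((L : ℝ) ^ 3 * β)) * (levelValue su2Rep L β k * levelValue su2Rep 1 ((L : ℝ) ^ 3 * β) 0) := by
    filter_upwards [lambda0_le_record hL2 (half_pos hε), levelFloor_record hL2 k (half_pos hε), Filter.eventually_ge_atTop (1 : ℝ)] with β hU hF hβ1
    have hβ0 : 0 < β := by linarith only [hβ1]
    have hB0 : 0 < (L : ℝ) ^ 3 * β := by nlinarith only [hL1, hβ0]
    have hμk : 0 ≤ levelValue su2Rep 1 ((L : ℝ) ^ 3 * β) k := (levelValue_su2Rep_pos (L := 1) hB0 k).le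
    have hμ0 : 0 ≤ levelValue su2Rep 1 ((L : ℝ) ^ 3 * β) 0 := (levelValue_su2Rep_pos (L := 1) hB0 0).le
    have hσ : 0 ≤ recordSigma L β := (recordSigma_pos (L := L) hβ0.le).le
    -- `μ_k λ₀ ≤ μ_k e^{ε/2 λ} σ μ₀ = e^{ε λ} μ₀ · (e^{−ε/2 λ} σ μ_k) ≤ e^{ελ} μ₀ λ_k`
    have h1 := mul_le_mul_of_nonneg_left hU hμk
    have h2 := mul_le_mul_of_nonneg_left hF (show 0 ≤ Real.exp (ε * bareLambda ((L : ℝ) ^ 3 * β)) * levelValue su2Rep 1 ((L : ℝ) ^ 3 * β) 0 by positivity)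
    have e : levelValue su2Rep 1 ((L : ℝ) ^ 3 * β) k * (Real.exp (ε / 2 * bareLambda ((L : ℝ) ^ 3 * β)) * (recordSigma L β * levelValue su2Rep 1 ((L : ℝ) ^ 3 * β) 0)) =
        Real.exp (ε * bareLambda ((L : ℝ) ^ 3 * β)) * levelValue su2Rep 1 ((L : ℝ) ^ 3 * β) 0 *
          (Real.exp (-(ε / 2 * bareLambda ((L : ℝ) ^ 3 * β))) * (recordSigma L β * levelValue su2Rep 1 ((L : ℝ) ^ 3 * β) k)) := by
      have : Real.exp (ε * bareLambda ((L : ℝ) ^ 3 * β)) = Real.exp (ε / 2 * bareLambda ((L : ℝ) ^ 3 * β)) * Real.exp (ε / 2 * bareLambda ((L : ℝ) ^ 3 * β)) := by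
        rw [← Real.exp_add]; ring_nf
      rw [this, Real.exp_neg]
      field_simp
    rw [e] at h1
    calc levelValue su2Rep 1 ((L : ℝ) ^ 3 * β) k * levelValue su2Rep L β 0
        ≤ Real.exp (ε * bareLambda ((L : ℝ) ^ 3 * β)) * levelValue su2Rep 1 ((L : ℝ) ^ 3 * β) 0 *
            (Real.exp (-(ε / 2 * bareLambda ((L : ℝ) ^ 3 * β))) * (recordSigma L β * levelValue su2Rep 1 ((L : ℝ) ^ 3 * β) k)) := h1
      _ ≤ Real.exp (ε * bareLambda ((L : ℝ) ^ 3 * β)) * levelValue su2Rep 1 ((L : ℝ) ^ 3 * β) 0 * levelValue su2Rep L β k := h2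
      _ = Real.exp (ε * bareLambda ((L : ℝ) ^ 3 * β)) * (levelValue su2Rep L β k * levelValue su2Rep 1 ((L : ℝ) ^ 3 * β) 0) := by ring
  obtain ⟨β0, hβ0⟩ := Filter.eventually_atTop.mp hev
  exact ⟨β0, hβ0⟩

end Summit.QuantumFields.YangMills.Theorems.FemtoTransferGap.TwoLattice.ConstTube

end
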